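import Literature.Analysis.UnboundedOperators.SemigroupLaplaceResolventIdentity
import Literature.Analysis.OperatorTheory.PseudoResolventOperator
import Mathlib.Analysis.Calculus.Deriv.Slope
import HarnessLib

/-!
# The Laplace transform of a C₀-semigroup, part 4: `R(λ) = (λ − A)⁻¹` for the generator `A`
  (Engel–Nagel II Thm. 1.10 (ii)–(iii)) — the pseudo-resolvent's closed operator IS the generator

Analysis/UnboundedOperators proofs-layer file (theorems only, no definitions, no named facts),
completing Engel–Nagel (2000), Ch. II Thm. 1.10 for the tree's `C0Semigroup ℂ E` with
`‖T(t)‖ ≤ M e^{ωt}` and `R(λ) x = ∫₀^∞ e^{−λt} T(t) x dt` (`Re λ > ω`):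

* `tendsto_slope_app_laplaceResolventFun`: `h⁻¹ (T(h) R(λ) x − R(λ) x) → λ R(λ) x − x` as
  `h ↓ 0` (from `T(h) R(λ) x = e^{λh}(R(λ)x − ∫₀ʰ e^{−λu}T(u)x du)`);
* `laplaceResolventFun_mem_generator_domain`, `generator_laplaceResolventFun`:
  **`R(λ) x ∈ D(A)` and `A R(λ) x = λ R(λ) x − x`**, i.e. `(λ − A) R(λ) = 1`;
* `laplaceResolventFun_generator`, `laplaceResolventFun_sub_generator`:
  **`R(λ) A x = λ R(λ) x − x` for `x ∈ D(A)`**, i.e. `R(λ)(λ − A) = 1` on `D(A)`;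
* `injective_laplaceResolvent`; and
* `operatorOfResolvent_laplaceResolvent_eq_generator`: the closed operator attached to the
  pseudo-resolvent `laplaceResolvent T hM` by `Literature.Analysis.OperatorTheory.operatorOfResolvent`
  (Kato VIII-§1.1) **equals the generator** `T.generator` (as partially defined operators).

So for semigroups the two unbounded-operator calculi of the tree agree, and eigenvalues of the
generator are exactly the resolvent-eigenvectors used by the Riesz-projection layer
(`IsPseudoResolvent.eigen_iff_apply_eq_inv_smul`).

## References

* K.-J. Engel, R. Nagel, *One-Parameter Semigroups for Linear Evolution Equations* (2000),
  Ch. II Thm. 1.10 (i)–(iii) and its proof ((1.13)–(1.14)). [EngelNagel2000]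
* T. Kato, *Perturbation Theory for Linear Operators* (1966), IX-§1.3, VIII-§1.1. [Kato1966]
-/

noncomputable section

open MeasureTheory Set Filter Topology Complex
open scoped NNReal

namespace Literature.Analysis.UnboundedOperators

namespace C0Semigroup

variable {E : Type*} [NormedAddCommGroup E] [NormedSpace ℂ E] [CompleteSpace E]

omit [CompleteSpace E] in
/-- The real scalar `((h⁻¹ : ℝ) : ℂ) • v` is `h⁻¹ • v`. [folklore] -/
theorem ofReal_inv_smul (h : ℝ) (v : E) : ((h⁻¹ : ℝ) : ℂ) • v = (h⁻¹ : ℝ) • v :=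
  (RCLike.real_smul_eq_coe_smul (K := ℂ) _ v).symm

/-- `h⁻¹ (e^{λh} − 1) → λ` as `h ↓ 0`. [folklore] -/
theorem tendsto_slope_exp (l : ℂ) :
    Tendsto (fun h : ℝ => (h⁻¹ : ℝ) • (Complex.exp (l * h) - 1)) (𝓝[>] 0) (𝓝 l) := by
  have h1 : HasDerivAt (fun y : ℂ => Complex.exp (l * y)) (Complex.exp (l * (0 : ℝ)) * (l * 1))
      ((0 : ℝ) : ℂ) :=
    (Complex.hasDerivAt_exp _).comp ((0 : ℝ) : ℂ) ((hasDerivAt_id ((0 : ℝ) : ℂ)).const_mul l)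
  have h2 : HasDerivAt (fun s : ℝ => Complex.exp (l * s)) l 0 := by
    have h := h1.comp_ofReal
    simp only [Complex.ofReal_zero, mul_zero, Complex.exp_zero, mul_one, one_mul] at h
    exact h
  have h3 := h2.tendsto_slope_zero_right
  simp only [zero_add, Complex.ofReal_zero, mul_zero, Complex.exp_zero] at h3
  exact h3

/-- `h⁻¹ ∫₀ʰ e^{−λu} T(u) x du → x` as `h ↓ 0`. [folklore] -/
theorem tendsto_slope_partial (T : C0Semigroup ℂ E) (l : ℂ) (x : E) :
    Tendsto (fun h : ℝ => (h⁻¹ : ℝ) •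
      ∫ u in (0 : ℝ)..h, Complex.exp (-(l * u)) • T.app (Real.toNNReal u) x) (𝓝[>] 0) (𝓝 x) := by
  have h := (hasDerivAt_partial T l x 0).tendsto_slope_zero_right
  simp only [zero_add, intervalIntegral.integral_same, sub_zero, Complex.ofReal_zero, mul_zero,
    neg_zero, Complex.exp_zero, Real.toNNReal_zero, app_zero, one_apply_eq_self,
    one_smul] at h
  exact h

/-- **The difference quotient of `R(λ) x` at `0`**: `h⁻¹ (T(h) R(λ) x − R(λ) x) → λ R(λ) x − x`
as `h ↓ 0`. [cite: EngelNagel2000, Ch. II Thm. 1.10 (proof of (ii))] -/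
theorem tendsto_slope_app_laplaceResolventFun (T : C0Semigroup ℂ E) {M ω : ℝ}
    (hM : ∀ t : ℝ≥0, ‖T.app t‖ ≤ M * Real.exp (ω * t)) {l : ℂ} (hl : ω < l.re) (x : E) :
    Tendsto (fun h : ℝ => ((h⁻¹ : ℝ) : ℂ) •
        (T.app h.toNNReal (T.laplaceResolventFun l x) - T.laplaceResolventFun l x))
      (𝓝[>] 0) (𝓝 (l • T.laplaceResolventFun l x - x)) := by
  have hlim : Tendsto (fun h : ℝ =>
      ((h⁻¹ : ℝ) • (Complex.exp (l * h) - 1)) • T.laplaceResolventFun l x -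
        Complex.exp (l * h) • ((h⁻¹ : ℝ) •
          ∫ u in (0 : ℝ)..h, Complex.exp (-(l * u)) • T.app (Real.toNNReal u) x))
      (𝓝[>] 0) (𝓝 (l • T.laplaceResolventFun l x - (1 : ℂ) • x)) := by
    refine ((tendsto_slope_exp l).smul_const _).sub ?_
    have hexp : Tendsto (fun h : ℝ => Complex.exp (l * h)) (𝓝[>] 0) (𝓝 1) := by
      have hc : Continuous fun h : ℝ => Complex.exp (l * h) :=
        Complex.continuous_exp.comp (continuous_const.mul Complex.continuous_ofReal)
      have h := hc.continuousAt (x := (0 : ℝ))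
      rw [ContinuousAt, Complex.ofReal_zero, mul_zero, Complex.exp_zero] at h
      exact h.mono_left nhdsWithin_le_nhds
    exact hexp.smul (tendsto_slope_partial T l x)
  rw [one_smul] at hlim
  refine hlim.congr' ?_
  filter_upwards [self_mem_nhdsWithin] with h hh
  have hr : ∀ v : E, (h⁻¹ : ℝ) • v = ((h⁻¹ : ℝ) : ℂ) • v := fun v => (ofReal_inv_smul h v).symm
  rw [app_laplaceResolventFun T hM hl x, Real.coe_toNNReal h (le_of_lt hh), Complex.real_smul, hr]
  module

/-- **`R(λ) x ∈ D(A)`**. [cite: EngelNagel2000, Ch. II Thm. 1.10 (ii)] -/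
theorem laplaceResolventFun_mem_generator_domain (T : C0Semigroup ℂ E) {M ω : ℝ}
    (hM : ∀ t : ℝ≥0, ‖T.app t‖ ≤ M * Real.exp (ω * t)) {l : ℂ} (hl : ω < l.re) (x : E) :
    T.laplaceResolventFun l x ∈ T.generator.domain :=
  (T.mem_generator_domain_iff _).2 ⟨_, tendsto_slope_app_laplaceResolventFun T hM hl x⟩

/-- **`A R(λ) x = λ R(λ) x − x`**, i.e. `(λ − A) R(λ) x = x`. [cite: EngelNagel2000, Ch. II Thm. 1.10 (ii)] -/
theorem generator_laplaceResolventFun (T : C0Semigroup ℂ E) {M ω : ℝ}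
    (hM : ∀ t : ℝ≥0, ‖T.app t‖ ≤ M * Real.exp (ω * t)) {l : ℂ} (hl : ω < l.re) (x : E) :
    T.generator ⟨T.laplaceResolventFun l x, laplaceResolventFun_mem_generator_domain T hM hl x⟩ =
      l • T.laplaceResolventFun l x - x :=
  T.generator_apply_eq_of_tendsto _ (tendsto_slope_app_laplaceResolventFun T hM hl x)

/-- **`R(λ) A x = λ R(λ) x − x` for `x ∈ D(A)`** (`R(λ)` commutes with the difference quotients
and is continuous). [cite: EngelNagel2000, Ch. II Thm. 1.10 (iii)] -/
theorem laplaceResolventFun_generator (T : C0Semigroup ℂ E) {M ω : ℝ}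
    (hM : ∀ t : ℝ≥0, ‖T.app t‖ ≤ M * Real.exp (ω * t)) {l : ℂ} (hl : ω < l.re)
    (x : T.generator.domain) :
    T.laplaceResolventFun l (T.generator x) = l • T.laplaceResolventFun l x - x := by
  -- `R(λ)` applied to the difference quotients of `x` gives the difference quotients of `R(λ) x`
  have h1 : Tendsto (fun h : ℝ => T.laplaceResolventCLM hM hl
      (((h⁻¹ : ℝ) : ℂ) • (T.app h.toNNReal (x : E) - x))) (𝓝[>] 0)
      (𝓝 (T.laplaceResolventCLM hM hl (T.generator x))) :=
    ((T.laplaceResolventCLM hM hl).continuous.tendsto _).comp (T.tendsto_generator x)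
  have h2 : (fun h : ℝ => T.laplaceResolventCLM hM hl
      (((h⁻¹ : ℝ) : ℂ) • (T.app h.toNNReal (x : E) - x))) =
      fun h : ℝ => ((h⁻¹ : ℝ) : ℂ) •
        (T.app h.toNNReal (T.laplaceResolventFun l x) - T.laplaceResolventFun l x) := by
    funext h
    rw [map_smul, map_sub, laplaceResolventCLM_apply, laplaceResolventCLM_apply,
      app_laplaceResolventFun_comm T hM hl]
  rw [h2] at h1
  rw [← laplaceResolventCLM_apply T hM hl]
  exact tendsto_nhds_unique h1 (tendsto_slope_app_laplaceResolventFun T hM hl x)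

/-- **`R(λ) (λ x − A x) = x` for `x ∈ D(A)`**. [cite: EngelNagel2000, Ch. II Thm. 1.10 (iii)] -/
theorem laplaceResolventFun_sub_generator (T : C0Semigroup ℂ E) {M ω : ℝ}
    (hM : ∀ t : ℝ≥0, ‖T.app t‖ ≤ M * Real.exp (ω * t)) {l : ℂ} (hl : ω < l.re)
    (x : T.generator.domain) :
    T.laplaceResolventFun l (l • (x : E) - T.generator x) = x := by
  have hlin : T.laplaceResolventFun l (l • (x : E) - T.generator x) =
      l • T.laplaceResolventFun l x - T.laplaceResolventFun l (T.generator x) := by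
    rw [← laplaceResolventCLM_apply T hM hl, map_sub, map_smul, laplaceResolventCLM_apply,
      laplaceResolventCLM_apply]
  rw [hlin, laplaceResolventFun_generator T hM hl x]
  abel

/-- **`R(λ)` is injective** (`R(λ) x = 0 ⟹ x = λ R(λ)x − A R(λ) x = 0`). [cite: EngelNagel2000, Ch. II Thm. 1.10 (ii)] -/
theorem injective_laplaceResolvent (T : C0Semigroup ℂ E) {M ω : ℝ}
    (hM : ∀ t : ℝ≥0, ‖T.app t‖ ≤ M * Real.exp (ω * t)) {l : ℂ} (hl : ω < l.re) :
    Function.Injective (T.laplaceResolvent hM l) := by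
  refine (injective_iff_map_eq_zero _).2 fun x hx => ?_
  rw [laplaceResolvent_apply T hM hl] at hx
  have h := generator_laplaceResolventFun T hM hl x
  have h0 : T.generator ⟨T.laplaceResolventFun l x,
      laplaceResolventFun_mem_generator_domain T hM hl x⟩ = 0 := by
    have : (⟨T.laplaceResolventFun l x, laplaceResolventFun_mem_generator_domain T hM hl x⟩ :
        T.generator.domain) = 0 := Subtype.ext hx
    rw [this, LinearPMap.map_zero]
  rw [h0, hx, smul_zero, zero_sub] at h
  exact neg_eq_zero.1 h.symm

/-- **The closed operator of the pseudo-resolvent `λ ↦ R(λ)` is the generator**: for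
`Re z₀ > ω`, `operatorOfResolvent (laplaceResolvent T hM) z₀ _ = T.generator` (Kato's
VIII-§1.1 operator attached to the resolvent family coincides with Engel–Nagel's generator —
Thm. II.1.10: `R(λ) = R(λ, A)`). [cite: EngelNagel2000, Ch. II Thm. 1.10; Kato1966 VIII-§1.1] -/
theorem operatorOfResolvent_laplaceResolvent_eq_generator (T : C0Semigroup ℂ E) {M ω : ℝ}
    (hM : ∀ t : ℝ≥0, ‖T.app t‖ ≤ M * Real.exp (ω * t)) {z₀ : ℂ} (hz₀ : ω < z₀.re) :
    Literature.Analysis.OperatorTheory.operatorOfResolvent (T.laplaceResolvent hM) z₀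
        (injective_laplaceResolvent T hM hz₀) = T.generator := by
  apply LinearPMap.eq_of_eq_graph
  ext p
  rw [Literature.Analysis.OperatorTheory.mem_graph_operatorOfResolvent_iff, LinearPMap.mem_graph_iff,
    laplaceResolvent_apply T hM hz₀]
  constructor
  · intro hp
    refine ⟨⟨p.1, ?_⟩, rfl, ?_⟩
    · rw [← hp]
      exact laplaceResolventFun_mem_generator_domain T hM hz₀ _
    · have h := generator_laplaceResolventFun T hM hz₀ (z₀ • p.1 - p.2)
      have heq : (⟨T.laplaceResolventFun z₀ (z₀ • p.1 - p.2),
          laplaceResolventFun_mem_generator_domain T hM hz₀ _⟩ : T.generator.domain) =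
          ⟨p.1, by rw [← hp]; exact laplaceResolventFun_mem_generator_domain T hM hz₀ _⟩ :=
        Subtype.ext hp
      rw [heq] at h
      rw [h, hp]
      abel
  · rintro ⟨y, hy1, hy2⟩
    have h := laplaceResolventFun_sub_generator T hM hz₀ y
    rw [hy2, hy1] at h
    exact h

end C0Semigroup

end Literature.Analysis.UnboundedOperators
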